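import Mathlib

/-!
# B3 BLOCK-TRACE in twisted rooms — letter-level count laws (hsemireg-monad-4 g15; v2 g16)

v2 (g16, 2026-08-30): §6 CORRECTED per idea-crit-hsem-2 memo-106 (LEMMA SPLIT-OFF §2.7 FAIL ×2): `X = (E_i × E_i)^4` is an
abelian EIGHT-fold, `h^{p,q}(X) = C(8,p)·C(8,q)` — v1's `hodgeTorus4 = C(4,p)·C(4,q)` rows were true statements about a
4-torus, not about `X`; v1's `splitOffLB`, `splitOffLB_five/_sixteen/_pos` are WITHDRAWN (the struck count `6 s - 28`);
§6 now carries the 8-fold rows, the vacuity of the struck pigeonhole (`28 s - 8008 = 0` for `s ≤ 286`) and the counts of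
the replacement LEMMA SPLIT-OFF′ (a) `28 (n - 1)` ∕ (b) `16` (memo g15 v1.1 §2.7′). §1–§5 are v1 VERBATIM.

Companion to memo `Cruxes/BlochSeedDiscOne/B3-BLOCKTRACE-TW-monad4-g15.md` (THEOREM BLOCK-TRACE-TW).
Setting of the memo: a three-term complex `A → N → C` (or a two-term road) of sums of line bundles on
`X = (E_i × E_i)^4`, a letter `Z` of the top term whose `m` copies are split by per-copy `Pic⁰`-twists
into isomorphism classes `j` of sizes `m_j`; for each class, `t_j` = dimension of the span of the class-`j`
rows of the map into `Z` over FED or VISIBLE feeders, `σ_{f,j}` = dimension of the columns that a type-`η_f`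
cocycle must kill.  THEOREM BLOCK-TRACE-TW: `dim ⋂ ker σ ≥ β^tw := Σ_f [Σ_j (m_j - σ_{f,j})(m_j - t_j) - 1]₊`.

This file checks ONLY the elementary count laws used by the memo's corollaries (no geometry):
* `betaTwF_single`      — one class: the g14 count `(m-σ)(m-t) - 1` (THEOREM BLOCK-TRACE is the unsplit case);
* `survivors_anti_t/_s` — the count is antitone in `t_j` and in `σ_{f,j}` (letter counts τ ≥ t, τ_f ≥ σ give lower bounds);
* `sum_le_sum_sq`, `betaTwF_unfed_lb`, `betaTwF_unfed_pos` — COROLLARY TW-1: a block with no fed/visible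
  feeder (`t_j = 0`, letter count τ = 0) has, on every factor f with nothing to kill (`σ_{f,j} = 0`, letter count
  τ_f = 0), `β^tw_f ≥ m - 1 ≥ 1` in EVERY splitting (`m ≥ 2`); with φ such factors `β^tw ≥ φ (m - 1)`;
* `sum_sq_le_sq_sum`    — splitting never raises the unfed count: `Σ m_j² ≤ (Σ m_j)²`;
* `sum_survivors_units` — COROLLARY TW-2: in the full splitting (`m_j = 1`) the count is
  `#{j : t_j = 0 ∧ σ_{f,j} = 0} - 1`: silent as soon as all but one copy are hit;
* numeric rows: D136 / g5cand1 hub-in-N block (`m = 8`, unfed, invisible): 252 unsplit, 28 fully split;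
  TWIST ray `𝔇₁₆` with Theorem S (`t = σ = 12`): 60 unsplit, 0 when every copy is hit.
* `twistOutcome`, `feederTw_trivial`, `twist_visible_imp_aligned` — the combinatorial shadow of
  LEMMA TWIST-MONOTONE (per-factor outcome of a degree-0 twist: unchanged or dead), by `decide`.
* §6 (v2) `hodge8`, `sigmaTarget8`, `struckSplitOff_vacuous`, `splitOffPrimeA`, `splitOffPrimeA_pos` — the abelian-8-fold
  Hodge numbers, why v1's SPLIT-OFF pigeonhole is vacuous, and the SPLIT-OFF′ counts `28 (n - 1) ≥ 28` (n ≥ 2), `16`.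
Mathlib only; no `sorry`, no new axioms, no `instance` (not even derived ones), no notation, no unsafe options.
Designs ≠ displays ≠ sheaves ≠ SEED; nothing here is proved toward HC / HC_AV / 18881 / H2.
-/

namespace Summit.HodgeConjecture.HodgeConjecture.Cruxes.BlochSeedDiscOne.BlockTraceTwist

/-- One isomorphism class of copies of the top letter: multiplicity `m`, hit dimension `t`, killed dimension `s`. -/
structure ClassData where
  m : ℕ
  t : ℕ
  s : ℕ

/-- Surviving cocycle parameters of one class on one factor: `(m - s)(m - t)` (ℕ-subtraction). -/
def survivors (c : ClassData) : ℕ := (c.m - c.s) * (c.m - c.t)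

/-- `β^tw_f` for one factor `f`: `[Σ_j (m_j - σ_{f,j})(m_j - t_j) - 1]₊` (the `- 1` is the trace condition). -/
def betaTwF (cs : List ClassData) : ℕ := (cs.map survivors).sum - 1

/-! ## §1 The unsplit case and monotonicity -/

theorem betaTwF_single (m t s : ℕ) : betaTwF [⟨m, t, s⟩] = (m - s) * (m - t) - 1 := by
  simp [betaTwF, survivors]

theorem survivors_anti_t {m t t' s : ℕ} (h : t ≤ t') :
    survivors ⟨m, t', s⟩ ≤ survivors ⟨m, t, s⟩ := by
  unfold survivors
  exact Nat.mul_le_mul_left _ (Nat.sub_le_sub_left h _)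

theorem survivors_anti_s {m t s s' : ℕ} (h : s ≤ s') :
    survivors ⟨m, t, s'⟩ ≤ survivors ⟨m, t, s⟩ := by
  unfold survivors
  exact Nat.mul_le_mul_right _ (Nat.sub_le_sub_left h _)

/-- Letter-level surrogates: if classwise `m` agrees, `t_j ≤ τ_j` and `σ_j ≤ τ'_j`, the survivor sum computed
with the surrogates is a lower bound for the true survivor sum (Remark (a) of the g14 memo, classwise). -/
theorem sum_survivors_mono {cs ds : List ClassData}
    (h : List.Forall₂ (fun c d => c.m = d.m ∧ c.t ≤ d.t ∧ c.s ≤ d.s) cs ds) :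
    (ds.map survivors).sum ≤ (cs.map survivors).sum := by
  induction h with
  | nil => simp
  | @cons c d cs' ds' hcd _ ih =>
    obtain ⟨hm, ht, hs⟩ := hcd
    simp only [List.map_cons, List.sum_cons]
    have hd : survivors d ≤ survivors c := by
      unfold survivors
      rw [← hm]
      exact Nat.mul_le_mul (Nat.sub_le_sub_left hs _) (Nat.sub_le_sub_left ht _)
    omega

/-! ## §2 COROLLARY TW-1: unfed, invisible, nothing to kill ⇒ positive in every splitting -/

/-- The classes of an unfed block: `t_j = σ_{f,j} = 0`. -/
def unfedClasses (ms : List ℕ) : List ClassData := ms.map fun m => ⟨m, 0, 0⟩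

theorem survivors_unfed (m : ℕ) : survivors ⟨m, 0, 0⟩ = m * m := by simp [survivors]

theorem sum_survivors_unfed (ms : List ℕ) :
    ((unfedClasses ms).map survivors).sum = (ms.map fun m => m * m).sum := by
  induction ms with
  | nil => simp [unfedClasses]
  | cons a ms ih => simpa [unfedClasses, survivors_unfed] using ih

/-- `Σ m_j ≤ Σ m_j²`. -/
theorem sum_le_sum_sq (ms : List ℕ) : ms.sum ≤ (ms.map fun m => m * m).sum := by
  induction ms with
  | nil => simp
  | cons a ms ih =>
    simp only [List.sum_cons, List.map_cons]
    have : a ≤ a * a := by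
      rcases Nat.eq_zero_or_pos a with h | h
      · simp [h]
      · exact Nat.le_mul_of_pos_left a h
    omega

/-- COROLLARY TW-1 (count form): `β^tw_f ≥ m - 1` for an unfed invisible block, in every splitting. -/
theorem betaTwF_unfed_lb (ms : List ℕ) : ms.sum - 1 ≤ betaTwF (unfedClasses ms) := by
  unfold betaTwF
  rw [sum_survivors_unfed]
  have := sum_le_sum_sq ms
  omega

/-- COROLLARY TW-1 (verdict form): `m ≥ 2` copies ⇒ `β^tw_f ≥ 1` on every clean factor (τ = τ_f = 0), in every splitting. -/
theorem betaTwF_unfed_pos (ms : List ℕ) (hm : 2 ≤ ms.sum) : 1 ≤ betaTwF (unfedClasses ms) := by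
  have := betaTwF_unfed_lb ms
  omega

/-- Splitting never raises the unfed count: `Σ m_j² ≤ (Σ m_j)²`. -/
theorem sum_sq_le_sq_sum (ms : List ℕ) : (ms.map fun m => m * m).sum ≤ ms.sum * ms.sum := by
  induction ms with
  | nil => simp
  | cons a ms ih =>
    simp only [List.sum_cons, List.map_cons]
    nlinarith [ih, Nat.zero_le (a * ms.sum)]

/-! ## §3 COROLLARY TW-2: the full splitting -/

theorem survivors_unit (t s : ℕ) : survivors ⟨1, t, s⟩ = if t = 0 ∧ s = 0 then 1 else 0 := by
  rcases t with _ | t <;> rcases s with _ | s <;> simp [survivors]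

/-- In the full splitting (`m_j = 1` for all `j`) the survivor sum counts the copies that are neither hit
(`t_j = 0`) nor forced to be killed (`σ_{f,j} = 0`); hence `β^tw_f = #unhit - 1`. -/
theorem sum_survivors_units (cs : List ClassData) (h : ∀ c ∈ cs, c.m = 1) :
    (cs.map survivors).sum = cs.countP fun c => c.t = 0 ∧ c.s = 0 := by
  induction cs with
  | nil => simp
  | cons c cs ih =>
    have hc : c.m = 1 := h c (by simp)
    have ih' := ih (fun d hd => h d (by simp [hd]))
    obtain ⟨cm, ct, cs'⟩ := c
    simp only at hc
    subst hc
    simp only [List.map_cons, List.sum_cons, List.countP_cons, survivors_unit, ih']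
    by_cases hts : ct = 0 ∧ cs' = 0
    · simp [hts]; omega
    · simp [hts]

theorem betaTwF_units (cs : List ClassData) (h : ∀ c ∈ cs, c.m = 1) :
    betaTwF cs = (cs.countP fun c => c.t = 0 ∧ c.s = 0) - 1 := by
  unfold betaTwF
  rw [sum_survivors_units cs h]

/-- If every copy of the fully split block is hit (`t_j ≥ 1`), the count is silent on that factor. -/
theorem betaTwF_units_allHit (cs : List ClassData) (h : ∀ c ∈ cs, c.m = 1) (hhit : ∀ c ∈ cs, 1 ≤ c.t) :
    betaTwF cs = 0 := by
  have h0 : (cs.countP fun c => c.t = 0 ∧ c.s = 0) = 0 := by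
    apply List.countP_eq_zero.mpr
    intro c hc hp
    have h1 := hhit c hc
    have h2 : c.t = 0 ∧ c.s = 0 := of_decide_eq_true hp
    omega
  rw [betaTwF_units cs h, h0]

/-! ## §4 Numeric rows of the memo (Table TW) -/

/-- D136 / g5cand1 (LINE-16 on S131): hub block of the middle term, `m = 8`, no fed/visible feeder,
nothing to kill: unsplit `β_f = 63`, `β = 252`; fully split `β^tw_f = 7`, `β^tw = 28` (> 0: DOOR-DEAD in every room). -/
theorem row_D136_unsplit : betaTwF (unfedClasses [8]) = 63 := by decide
theorem row_D136_unsplit_total : 4 * betaTwF (unfedClasses [8]) = 252 := by decide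
theorem row_D136_fullSplit : betaTwF (unfedClasses [1, 1, 1, 1, 1, 1, 1, 1]) = 7 := by decide
theorem row_D136_fullSplit_total : 4 * betaTwF (unfedClasses [1, 1, 1, 1, 1, 1, 1, 1]) = 28 := by decide
/-- an intermediate splitting 8 = 4 + 2 + 2: `16 + 4 + 4 - 1 = 23` per factor. -/
theorem row_D136_split422 : betaTwF (unfedClasses [4, 2, 2]) = 23 := by decide

/-- TWIST ray `𝔇₁₆` (hub block of C, `m = c = 16`), cell-constant room with Theorem S (`t = σ_f = s = 12`):
`β_f = 15`, `β = 60` (memo g13); fully split with every copy hit: `0` (COROLLARY TW-2: count-silent). -/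
theorem row_D16_unsplit : betaTwF [⟨16, 12, 12⟩] = 15 := by decide
theorem row_D16_fullSplit_allHit : betaTwF (List.replicate 16 ⟨1, 1, 1⟩) = 0 := by decide
/-- fully split `𝔇₁₆` with `u = 3` unhit copies: `β^tw_f = 2`. -/
theorem row_D16_fullSplit_3unhit :
    betaTwF (List.replicate 13 ⟨1, 1, 1⟩ ++ List.replicate 3 ⟨1, 0, 0⟩) = 2 := by decide

/-! ## §5 LEMMA TWIST-MONOTONE — combinatorial shadow

Per factor, the difference class `D = Z_f - x_f` of a feeder is `zero`, `null` (effective, square 0) or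
`ample`; after twisting feeder and target copies by degree-0 classes whose difference on this factor is
`P`, the factor bundle `𝒪(D) ⊗ P` has (memo §2.3, from H^•(S, P) = 0 for P ≠ 0 and the fibration
sequence for null classes): the SAME cohomology as before if `P` is trivial, or (null case) if `P` lies on
the special 1-dimensional coset; and NO cohomology at all otherwise (`none`).  Ample factors are unchanged
by any `P`.  Consequence: a twisted feeder is an aligned feeder, a twisted-visible feeder is aligned-visible,
so the aligned letter counts `τ, τ_f` dominate `t_j, σ_{f,j}` in every twisted room. -/

/-- kind of a factor difference class -/
inductive FKind | zero | null | ample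

/-- position of the degree-0 twist on one factor relative to the difference class -/
inductive TwistPos | trivial | special | generic

/-- per-factor outcome of twisting: `some k` = cohomology table unchanged (kind `k`), `none` = all cohomology vanishes -/
def twistOutcome : FKind → TwistPos → Option FKind
  | .zero, .trivial => some .zero
  | .zero, .special => none
  | .zero, .generic => none
  | .null, .trivial => some .null
  | .null, .special => some .null
  | .null, .generic => none
  | .ample, _ => some .ample

/-- lowest degree in which the factor bundle `𝒪(-D)` has cohomology: zero ↦ 0, null ↦ 1, ample ↦ 2
(tables (1,2,1), (0,d,d), (0,0,χ)). -/
def minDeg : FKind → ℕ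
  | .zero => 0
  | .null => 1
  | .ample => 2

/-- the four factor kinds of a feeder, as a list of length 4 (we quantify over lists and check lengths) -/
def visibleAligned (ks : List FKind) : Bool := decide ((ks.map minDeg).sum ≤ 2)

/-- twisted feeder: every factor survives the twist -/
def feederTw (ks : List FKind) (ps : List TwistPos) : Bool :=
  (List.zipWith twistOutcome ks ps).all Option.isSome

/-- twisted visibility: every factor survives and the Künneth degree count still reaches H² -/
def visibleTw (ks : List FKind) (ps : List TwistPos) : Bool :=
  feederTw ks ps && decide ((((List.zipWith twistOutcome ks ps).filterMap id).map minDeg).sum ≤ 2)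

theorem twistOutcome_eq_or_none (k : FKind) (p : TwistPos) :
    twistOutcome k p = some k ∨ twistOutcome k p = none := by
  cases k <;> cases p <;> simp [twistOutcome]

/-- On surviving factors the kind is unchanged, so the surviving kinds are exactly the aligned kinds. -/
theorem filterMap_twistOutcome_of_all (ks : List FKind) (ps : List TwistPos) (hlen : ks.length = ps.length)
    (h : (List.zipWith twistOutcome ks ps).all Option.isSome = true) :
    (List.zipWith twistOutcome ks ps).filterMap id = ks := by
  induction ks generalizing ps with
  | nil => simp
  | cons k ks ih =>
    cases ps with
    | nil => simp at hlen
    | cons p ps =>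
      simp only [List.zipWith_cons_cons, List.all_cons, Bool.and_eq_true] at h ⊢
      obtain ⟨h1, h2⟩ := h
      have hlen' : ks.length = ps.length := by simpa using hlen
      rcases twistOutcome_eq_or_none k p with hk | hk
      · rw [hk, List.filterMap_cons_some (f := id) (a := some k) (b := k) rfl, ih ps hlen' h2]
      · rw [hk] at h1; simp at h1

/-- LEMMA TWIST-MONOTONE (shadow): twisted-visible ⇒ aligned-visible. -/
theorem twist_visible_imp_aligned (ks : List FKind) (ps : List TwistPos) (hlen : ks.length = ps.length)
    (h : visibleTw ks ps = true) : visibleAligned ks = true := by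
  unfold visibleTw at h
  simp only [Bool.and_eq_true] at h
  obtain ⟨hf, hdeg⟩ := h
  unfold feederTw at hf
  rw [filterMap_twistOutcome_of_all ks ps hlen hf] at hdeg
  unfold visibleAligned
  exact hdeg

/-- The aligned room is the twist with all positions trivial, and there every feeder survives. -/
theorem feederTw_trivial (ks : List FKind) :
    feederTw ks (List.replicate ks.length TwistPos.trivial) = true := by
  induction ks with
  | nil => simp [feederTw]
  | cons k ks ih =>
    unfold feederTw at ih ⊢
    simp only [List.length_cons, List.replicate_succ, List.zipWith_cons_cons, List.all_cons,
      Bool.and_eq_true]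
    refine ⟨?_, ih⟩
    cases k <;> simp [twistOutcome]

/-! ## §6 (v2) Hodge numbers of the abelian 8-fold and the SPLIT-OFF′ counts (memo g15 v1.1 §2.7′; memo-106 rider s1)
`X = S⁴`, `S = E_i × E_i` an abelian SURFACE, so `dim X = 8` and `h^{p,q}(X) = C(8,p)·C(8,q)` (as in g13 `B3HubTrace`:
`h¹(𝒪_X) = 8`, `h²(𝒪_X) = 28`, Σ_k h^{k,k+2} = 8008).  v1's §6 used `C(4,p)·C(4,q)` (a 4-torus): its theorems were
kernel-true statements about those binomials but NOT about `X`, and the gloss «`dim ⋂ ker σ ≥ 6 s - 28`» is STRUCK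
(memo-106: the diagonal split-off sector `(η_u)_u ↦ (Σ_u η_u ∪ c₁(y_u)^k)_k` is injective on all sixteen N18 cells, rank
448∕448).  What replaces it (LEMMA SPLIT-OFF′, memo g15 v1.1 §2.7′): (a) `n ≥ 2` isolated summands with EQUAL `c₁` give the
σ-blind subspace `{(η_u) : Σ_u η_u = 0} ⊂ ⊕_u H^{0,2}(X)` of dimension `28 (n - 1)`; (b) two isolated summands `y, y′` with
`H²(Hom(y,y′)) ≠ 0` give the σ-blind off-diagonal block `Ext²(y,y′)` (trace of an off-diagonal word vanishes), of dimension
`16` for a compatible same-phase N18 pair (ORPHAN-PAIR digit of record).  The linear algebra of (a) and (b) is kernel-checked in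
the g16 companion `B3BlockTraceSH.lean` §4 (`finrank_ker_blockSum`, `trace_offDiag_mul_diag_pow`); here only the digits. -/

/-- Hodge number `h^{p,q} = C(8,p)·C(8,q)` of a complex torus ∕ abelian variety of dimension 8 (`X = (E_i × E_i)^4`). -/
def hodge8 (p q : ℕ) : ℕ := Nat.choose 8 p * Nat.choose 8 q

theorem hodge8_01 : hodge8 0 1 = 8 := by decide
theorem hodge8_02 : hodge8 0 2 = 28 := by decide

/-- dimension of the target `H^{k,k+2}(X)` of `σ_k` restricted to `H^{0,2}`-type classes. -/
def sigmaTarget8 (k : ℕ) : ℕ := hodge8 k (k + 2)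

theorem sigmaTarget8_rows :
    (List.range 9).map sigmaTarget8 = [28, 448, 1960, 3136, 1960, 448, 28, 0, 0] := by decide

theorem sigmaTarget8_sum : ((List.range 7).map sigmaTarget8).sum = 8008 := by decide

/-- v1's pigeonhole with the CORRECT numbers reads `28 s - 8008` (ℕ-subtraction): vacuous for `s ≤ 286`
(memo-106 plate `critic_splitoff_8fold_vacuous`). -/
theorem struckSplitOff_vacuous (s : ℕ) (hs : s ≤ 286) :
    hodge8 0 2 * s - ((List.range 7).map sigmaTarget8).sum = 0 := by
  rw [hodge8_02, sigmaTarget8_sum]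
  omega

/-- LEMMA SPLIT-OFF′ (a): `n` isolated summands with equal `c₁` ⇒ `dim {(η_u) : Σ η_u = 0} = h^{0,2}(X)·(n - 1) = 28 (n - 1)`. -/
def splitOffPrimeA (n : ℕ) : ℕ := hodge8 0 2 * (n - 1)

theorem splitOffPrimeA_two : splitOffPrimeA 2 = 28 := by decide
theorem splitOffPrimeA_three : splitOffPrimeA 3 = 56 := by decide

/-- memo-106 positive controls: two copies of one cell → 28, three copies + one other cell → 56 (the other cell adds nothing). -/
theorem splitOffPrimeA_controls : splitOffPrimeA 2 = 28 ∧ splitOffPrimeA 3 + splitOffPrimeA 1 = 56 := by decide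

theorem splitOffPrimeA_pos (n : ℕ) (h : 2 ≤ n) : 28 ≤ splitOffPrimeA n := by
  unfold splitOffPrimeA
  rw [hodge8_02]
  have : 1 ≤ n - 1 := by omega
  calc 28 = 28 * 1 := by norm_num
    _ ≤ 28 * (n - 1) := Nat.mul_le_mul_left 28 this

/-- LEMMA SPLIT-OFF′ (b) digit of record: a compatible same-phase isolated N18 pair contributes the whole off-diagonal
`Ext²` block, `h²(Hom(N18_z, N18_{z′})) = 16` (ORPHAN-PAIR table, monad-1 `B3OrphanTables.orphans_level`); incompatible
pairs contribute `0`.  Recorded as data only. -/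
def splitOffPrimeB (compatible : Bool) : ℕ := if compatible then 16 else 0

theorem splitOffPrimeB_rows : splitOffPrimeB true = 16 ∧ splitOffPrimeB false = 0 := by decide

end Summit.HodgeConjecture.HodgeConjecture.Cruxes.BlochSeedDiscOne.BlockTraceTwist
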